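import Mathlib.Data.NNReal.Basic
import Mathlib.Algebra.BigOperators.Pi
import Mathlib.Algebra.Group.Pi.Lemmas
import Mathlib.Logic.Equiv.Defs
import HarnessLib

/-!
# Additive isomorphisms of cones `(ι₁ → ℝ≥0) ≃+ (ι₂ → ℝ≥0)` are monomial

Pure algebra (PROOF-ONLY; no definitions, no named facts).  An additive bijection
`g : (ι₁ → ℝ≥0) ≃+ (ι₂ → ℝ≥0)` between finite products of the cone `ℝ≥0` carries each coordinate ray
`ℝ≥0 · e_i` onto a coordinate ray `ℝ≥0 · e_{π i}` for a BIJECTION `π : ι₁ ≃ ι₂` (`exists_equiv_map_single`):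
additive maps of such cones are monotone, and the rays are characterised additively as the nonzero `t` all of
whose decompositions `t = a + b` are comparable (`a ≤ b ∨ b ≤ a`).  If moreover `g` preserves the coordinate sum,
then `g` is the coordinate permutation `π`: `g t (π i) = t i` (`apply_equiv_eq_of_sum_eq`).

Use (cell abc-iut, layer L1; GAP-LEDGER G-L1t3-1 #2): the archimedean component of an isomorphism
`Φ(L₁) ⥲ Φ(L₂)` of effective-arithmetic-divisor monoids (`EffArithDivisor.exists_decomposition`:
`e (f, t) = (π_* f, g t)` with `g` an additive bijection of the archimedean parts `V(L_i)^arc → ℝ≥0`) is a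
bijection of archimedean places once degrees are preserved.  Nothing here is specific to the disputed corpus.
-/

noncomputable section

open scoped NNReal

namespace Literature.AlgebraicGeometry.Frobenioids

namespace NNRealPi

variable {ι₁ ι₂ : Type*}

/-! ### Additive maps of `ℝ≥0`-cones are monotone -/

/-- An additive map `(ι₁ → ℝ≥0) →+ (ι₂ → ℝ≥0)` is monotone (`a ≤ b ⇒ b = a + (b - a)`). [cite: MochizukiFrdI2008, Thm. 6.4 (iv) p.115] -/
theorem monotone_addMonoidHom (g : (ι₁ → ℝ≥0) →+ (ι₂ → ℝ≥0)) : Monotone g := by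
  intro a b hab
  have hb : b = a + (b - a) := by
    funext i
    simp only [Pi.add_apply, Pi.sub_apply]
    exact (add_tsub_cancel_of_le (hab i)).symm
  rw [hb, map_add]
  exact fun i => le_self_add

/-! ### Rays: elements all of whose decompositions are comparable -/

/-- `t` has at most one nonzero coordinate iff all its additive decompositions are comparable. [cite: MochizukiFrdI2008, Thm. 6.4 (iv) p.115] -/
theorem forall_add_eq_comparable_iff [DecidableEq ι₁] (t : ι₁ → ℝ≥0) :
    (∀ a b : ι₁ → ℝ≥0, a + b = t → a ≤ b ∨ b ≤ a) ↔ ∀ i j, t i ≠ 0 → t j ≠ 0 → i = j := by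
  constructor
  · intro h i j hi hj
    by_contra hij
    -- `a = t_i e_i`, `b = t - a` are incomparable
    rcases h (Pi.single i (t i)) (t - Pi.single i (t i)) (by
      funext k
      simp only [Pi.add_apply, Pi.sub_apply]
      by_cases hk : k = i
      · subst hk; simp
      · simp [Pi.single_eq_of_ne hk]) with hle | hle
    · have := hle i
      simp only [Pi.single_eq_same, Pi.sub_apply, tsub_self, nonpos_iff_eq_zero] at this
      exact hi this
    · have := hle j
      simp only [Pi.sub_apply, tsub_zero, Pi.single_eq_of_ne (Ne.symm hij)] at this
      exact hj (le_antisymm this (zero_le))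
  · intro h a b hab
    -- every coordinate off the (at most one) nonzero coordinate `i₀` of `t` vanishes for `a` and `b`
    have hzero : ∀ k, t k = 0 → a k = 0 ∧ b k = 0 := fun k hk => by
      have := congrFun hab k
      rw [Pi.add_apply, hk, add_eq_zero] at this
      exact this
    by_cases ht : ∃ i, t i ≠ 0
    · obtain ⟨i, hi⟩ := ht
      rcases le_total (a i) (b i) with hab' | hab'
      · left
        intro k
        by_cases hk : t k = 0
        · rw [(hzero k hk).1]; exact zero_le
        · rw [h k i hk hi]; exact hab'
      · right
        intro k
        by_cases hk : t k = 0
        · rw [(hzero k hk).2]; exact zero_le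
        · rw [h k i hk hi]; exact hab'
    · push Not at ht
      left
      intro k
      rw [(hzero k (ht k)).1]
      exact zero_le

/-- An additive isomorphism preserves "all decompositions comparable". [cite: MochizukiFrdI2008, Thm. 6.4 (iv) p.115] -/
theorem forall_add_eq_comparable_map (g : (ι₁ → ℝ≥0) ≃+ (ι₂ → ℝ≥0)) {t : ι₁ → ℝ≥0}
    (ht : ∀ a b : ι₁ → ℝ≥0, a + b = t → a ≤ b ∨ b ≤ a) :
    ∀ a b : ι₂ → ℝ≥0, a + b = g t → a ≤ b ∨ b ≤ a := by
  intro a b hab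
  have h := ht (g.symm a) (g.symm b) (by rw [← map_add, hab, AddEquiv.symm_apply_apply])
  have hmono := monotone_addMonoidHom (g : (ι₁ → ℝ≥0) →+ (ι₂ → ℝ≥0))
  rcases h with h | h
  · left; simpa using hmono h
  · right; simpa using hmono h

/-- A function with at most one nonzero coordinate, nonzero at `j`, is `e_j`-proportional. [cite: MochizukiFrdI2008, Thm. 6.4 (iv) p.115] -/
theorem eq_single_of_subsingleton_support [DecidableEq ι₂] {s : ι₂ → ℝ≥0}
    (hs : ∀ i j, s i ≠ 0 → s j ≠ 0 → i = j) {j : ι₂} (hj : s j ≠ 0) : s = Pi.single j (s j) := by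
  funext k
  by_cases hk : k = j
  · subst hk; simp
  · rw [Pi.single_eq_of_ne hk]
    by_contra hsk
    exact hk (hs k j hsk hj)

/-! ### Rays go to rays -/

/-- The image of a nonzero multiple of `e_i` under an additive isomorphism is a nonzero multiple of some `e_j`.
[cite: MochizukiFrdI2008, Thm. 6.4 (iv) p.115] -/
theorem exists_map_single_eq [DecidableEq ι₁] [DecidableEq ι₂] (g : (ι₁ → ℝ≥0) ≃+ (ι₂ → ℝ≥0))
    (i : ι₁) {r : ℝ≥0} (hr : r ≠ 0) :
    ∃ (j : ι₂) (r' : ℝ≥0), r' ≠ 0 ∧ g (Pi.single i r : ι₁ → ℝ≥0) = (Pi.single j r' : ι₂ → ℝ≥0) := by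
  have hax : ∀ a b : ι₁ → ℝ≥0, a + b = Pi.single i r → a ≤ b ∨ b ≤ a :=
    (forall_add_eq_comparable_iff _).mpr fun k l hk hl => by
      have hk' : k = i := by by_contra h; exact hk (Pi.single_eq_of_ne h _)
      have hl' : l = i := by by_contra h; exact hl (Pi.single_eq_of_ne h _)
      rw [hk', hl']
  have hax' := (forall_add_eq_comparable_iff _).mp (forall_add_eq_comparable_map g hax)
  have hne : g (Pi.single i r) ≠ 0 := by
    intro h0
    have : (Pi.single i r : ι₁ → ℝ≥0) = 0 := by simpa using congrArg g.symm h0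
    exact hr (by simpa using congrFun this i)
  obtain ⟨j, hj⟩ : ∃ j, g (Pi.single i r) j ≠ 0 := by
    by_contra h
    push Not at h
    exact hne (funext h)
  exact ⟨j, g (Pi.single i r) j, hj, eq_single_of_subsingleton_support hax' hj⟩

/-- Comparable nonzero multiples of coordinate vectors lie on the same ray. [cite: MochizukiFrdI2008, Thm. 6.4 (iv) p.115] -/
theorem eq_of_single_le_single [DecidableEq ι₂] {j j' : ι₂} {a a' : ℝ≥0} (ha : a ≠ 0)
    (h : (Pi.single j a : ι₂ → ℝ≥0) ≤ (Pi.single j' a' : ι₂ → ℝ≥0)) : j = j' := by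
  by_contra hjj
  have := h j
  rw [Pi.single_eq_same, Pi.single_eq_of_ne hjj] at this
  exact ha (le_antisymm this (zero_le))

/-- **Additive isomorphisms of `ℝ≥0`-cones are monomial**: there is a bijection `π : ι₁ ≃ ι₂` with
`g (ℝ≥0 · e_i) = ℝ≥0 · e_{π i}` for every `i`. [cite: MochizukiFrdI2008, Thm. 6.4 (iv) p.115] -/
theorem exists_equiv_map_single [DecidableEq ι₁] [DecidableEq ι₂] (g : (ι₁ → ℝ≥0) ≃+ (ι₂ → ℝ≥0)) :
    ∃ π : ι₁ ≃ ι₂, ∀ (i : ι₁) (r : ℝ≥0), ∃ r' : ℝ≥0, g (Pi.single i r : ι₁ → ℝ≥0) = (Pi.single (π i) r' : ι₂ → ℝ≥0) := by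
  classical
  -- the ray of `g e_i`
  choose J R hR hJ using fun i : ι₁ => exists_map_single_eq g i (one_ne_zero (α := ℝ≥0))
  have hmono := monotone_addMonoidHom (g : (ι₁ → ℝ≥0) →+ (ι₂ → ℝ≥0))
  have hmono' := monotone_addMonoidHom (g.symm : (ι₂ → ℝ≥0) →+ (ι₁ → ℝ≥0))
  -- the ray of `g (r e_i)` does not depend on `r ≠ 0`
  have hray : ∀ (i : ι₁) (r : ℝ≥0), r ≠ 0 → ∃ r' : ℝ≥0, g (Pi.single i r : ι₁ → ℝ≥0) = (Pi.single (J i) r' : ι₂ → ℝ≥0) := by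
    intro i r hr
    obtain ⟨j, r', hr', hj⟩ := exists_map_single_eq g i hr
    have hm : min r 1 ≠ 0 := by
      rcases min_choice r 1 with h | h <;> rw [h]
      · exact hr
      · exact one_ne_zero
    obtain ⟨j₀, r₀, hr₀, hj₀⟩ := exists_map_single_eq g i hm
    have h1 : (Pi.single j₀ r₀ : ι₂ → ℝ≥0) ≤ (Pi.single j r' : ι₂ → ℝ≥0) := by
      rw [← hj₀, ← hj]
      exact hmono (by
        intro k; by_cases hk : k = i
        · subst hk; simp
        · simp [Pi.single_eq_of_ne hk])
    have h2 : (Pi.single j₀ r₀ : ι₂ → ℝ≥0) ≤ (Pi.single (J i) (R i) : ι₂ → ℝ≥0) := by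
      rw [← hj₀, ← hJ]
      exact hmono (by
        intro k; by_cases hk : k = i
        · subst hk; simp
        · simp [Pi.single_eq_of_ne hk])
    have e1 := eq_of_single_le_single hr₀ h1
    have e2 := eq_of_single_le_single hr₀ h2
    exact ⟨r', by rw [hj, ← e1, e2]⟩
  -- `J` is a bijection
  have hinj : Function.Injective J := by
    intro i i' hii'
    rcases le_total (R i) (R i') with hle | hle
    · have h1 : g (Pi.single i 1) ≤ g (Pi.single i' 1) := by
        rw [hJ, hJ, hii']
        intro k; by_cases hk : k = J i'
        · subst hk; simpa using hle
        · simp [Pi.single_eq_of_ne hk]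
      have h2 : (Pi.single i 1 : ι₁ → ℝ≥0) ≤ (Pi.single i' 1 : ι₁ → ℝ≥0) := by simpa using hmono' h1
      exact eq_of_single_le_single one_ne_zero h2
    · have h1 : g (Pi.single i' 1) ≤ g (Pi.single i 1) := by
        rw [hJ, hJ, hii']
        intro k; by_cases hk : k = J i'
        · subst hk; simpa using hle
        · simp [Pi.single_eq_of_ne hk]
      have h2 : (Pi.single i' 1 : ι₁ → ℝ≥0) ≤ (Pi.single i 1 : ι₁ → ℝ≥0) := by simpa using hmono' h1
      exact (eq_of_single_le_single one_ne_zero h2).symm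
  have hsurj : Function.Surjective J := by
    intro j
    obtain ⟨i, a, ha, hi⟩ := exists_map_single_eq g.symm j (one_ne_zero (α := ℝ≥0))
    obtain ⟨r', hr'⟩ := hray i a ha
    refine ⟨i, ?_⟩
    have h : (Pi.single j 1 : ι₂ → ℝ≥0) = (Pi.single (J i) r' : ι₂ → ℝ≥0) := by
      rw [← hr', ← hi, AddEquiv.apply_symm_apply]
    have := congrFun h j
    rw [Pi.single_eq_same] at this
    by_contra hne
    rw [Pi.single_eq_of_ne (Ne.symm hne)] at this
    exact one_ne_zero this
  refine ⟨Equiv.ofBijective J ⟨hinj, hsurj⟩, fun i r => ?_⟩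
  by_cases hr : r = 0
  · refine ⟨0, ?_⟩
    rw [hr, Pi.single_zero, Pi.single_zero, map_zero]
  · exact hray i r hr

/-- **A sum-preserving additive isomorphism of `ℝ≥0`-cones is a coordinate permutation**: if
`Σ_j (g t)_j = Σ_i t_i` for all `t`, then `(g t)_{π i} = t_i` for the bijection `π` of `exists_equiv_map_single`.
[cite: MochizukiFrdI2008, Thm. 6.4 (iv) p.115] -/
theorem apply_equiv_eq_of_sum_eq [Fintype ι₁] [Fintype ι₂] [DecidableEq ι₁] [DecidableEq ι₂]
    (g : (ι₁ → ℝ≥0) ≃+ (ι₂ → ℝ≥0)) (π : ι₁ ≃ ι₂)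
    (hπ : ∀ (i : ι₁) (r : ℝ≥0), ∃ r' : ℝ≥0, g (Pi.single i r : ι₁ → ℝ≥0) = (Pi.single (π i) r' : ι₂ → ℝ≥0))
    (hsum : ∀ t : ι₁ → ℝ≥0, ∑ j, g t j = ∑ i, t i) (t : ι₁ → ℝ≥0) (i : ι₁) : g t (π i) = t i := by
  -- on rays: `g (r e_i) = r e_{π i}`
  have hsingle : ∀ (i : ι₁) (r : ℝ≥0), g (Pi.single i r : ι₁ → ℝ≥0) = (Pi.single (π i) r : ι₂ → ℝ≥0) := by
    intro i r
    obtain ⟨r', hr'⟩ := hπ i r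
    have hs := hsum (Pi.single i r)
    rw [hr', Finset.sum_pi_single', Finset.sum_pi_single'] at hs
    simp only [Finset.mem_univ, if_true] at hs
    rw [hr', hs]
  -- in general by additivity
  conv_lhs => rw [← Finset.univ_sum_single t, map_sum]
  rw [Finset.sum_apply, Finset.sum_eq_single i]
  · rw [hsingle, Pi.single_eq_same]
  · intro k _ hk
    rw [hsingle, Pi.single_eq_of_ne (fun h => hk (π.injective h).symm)]
  · intro h; exact absurd (Finset.mem_univ i) h

end NNRealPi

end Literature.AlgebraicGeometry.Frobenioids

end
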